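import Literature.NumberTheory.EllipticCurves.Zywina2025RankTwo
import Summits.BirchSwinnertonDyer.BirchSwinnertonDyer.Theorems.GoldfeldAllTwistsTwoConverseTwinGenusDescentRankZero
import HarnessLib

set_option linter.dupNamespace false -- `Summit.BirchSwinnertonDyer.BirchSwinnertonDyer.Theorems.…` (summit = sub)
set_option autoImplicit false

/-!
# Crux `HeegnerTwistCouplingInSupply` (stmt-BirchSwinnertonDyer-21381) — local lemmas for the QUARTIC cell of `j = 1728`:
# `ℚ_r`-insolubility of diagonal quartics `w² = d u⁴ + d′ z⁴`, and the `2`-adic residues of the classes `q`, `pq`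

Route `BiquadraticEisensteinDescent` (cell `pub/bsd-wall`, width seat `bsd-wall-cm-bed-w3` g12; `--supports` 21381, helper). First of
two files on the QUARTIC members `X_A : y² = x³ + A x`, `A ∈ {p, p³}`, `p ≡ 3 (mod 4)` (Kodaira III/III* at `p`, depth-zero supercuspidal,
CM by `ℤ[i]` with `p` inert; root number `−1` exactly for `p ≡ 15 (mod 16)`) of the CM-inert-bad corner of crux 21381: the sequel
`…HeegnerTwistCouplingInSupplyQuarticCell` runs the complete `2`-isogeny descent (Silverman AEC X.4.9, tree vocabulary
`twoIsogenySelmerGroup 0 B` / `twoIsogenySelmerGroup' 0 B`) of the Heegner twists `X_{p^k q² l²}` in the cell `p ≡ 15 (mod 16)`,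
`q ≡ 3 (mod 8)`, `(q/p) = +1`, `l ≡ 5 (mod 8)`, `(l/p) = −1`. This file holds the LOCAL inputs, all for the diagonal quartics
`twoIsogenyQuartic 0 d d′ = ⟨d, 0, 0, 0, d′⟩` (`w² = d u⁴ + d′ z⁴`), through the chart normal form
`Zywina2025.exists_padicInt_of_isSoluble` (a `ℚ_r`-point gives `s, t ∈ ℤ_r` with `s² = e + e′ t⁴`, `(e, e′) ∈ {(d, d′), (d′, d)}`):

* §1 `not_isSoluble_padic_of_nonsquare_of_sq_mul` — `d` a non-residue mod `r`, `d′ = r² e′`, `e′` a non-residue ⇒ no `ℚ_r`-point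
  (the `q`-adic death of the classes `−1, 2, p, −2p` of `S^{(φ)}`); `…_of_nonsquare_of_dvd` / `…_of_nonsquare_of_cube_mul` — `d` a
  non-residue, `d′ = r e′` resp. `r³ e′` with `r ∤ e′` (the `p`-adic death of the class `−2`, `k = 1, 3`); `…_of_dvd_of_sq_mul` — `r ∥ d`,
  `d′ = r² e′`, `e′` a non-residue (the class `2p`, `k = 3`; for `k = 1` it is `XCubeAddPX.not_isSoluble_padic_diagonal`);
* §2 the `2`-adic residues: with `p ≡ 15 (mod 16)`, `l ≡ 5 (mod 8)` one has `p^k ≡ 15`, `l² ≡ 9 (mod 16)`, and for `q = 8N + 3` both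
  charts of the classes `q` (`B/q = p^k q l²`) and `pq` (`B/(pq) = p^{k−1} q l²`) of `S^{(φ̂)}(X_B)` are insoluble modulo `16`
  (`zmod_key_q`, `zmod_key_pq` by `decide`; `not_isSoluble_two_q`, `not_isSoluble_two_pq` via
  `GoldfeldGoodTwists.not_isSoluble_two_of_zmodPow`). At `p ≡ 7 (mod 16)` the class `q` IS `2`-adically soluble (`x⁴ = 48 − p^k l²` is an
  odd fourth power in `ℤ₂`) — which is why the cell asks `p ≡ 15 (mod 16)`.

HONEST FRAMING: elementary local arithmetic; nothing about Selmer groups, `L`-values, the crux (all CM `W` of analytic rank one; residual C⁺)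
or BSD is asserted here. THEOREMS ONLY (no definition, no named fact); supports stmt-BirchSwinnertonDyer-21381.
-/

noncomputable section

namespace Summit.BirchSwinnertonDyer.BirchSwinnertonDyer.Theorems.BiquadraticEisensteinDescentHeegnerTwistCouplingInSupplyQuarticLocal

open Literature.NumberTheory.EllipticCurves
open Literature.NumberTheory.EllipticCurves.Zywina2025 (exists_padicInt_of_isSoluble)
open Summit.BirchSwinnertonDyer.BirchSwinnertonDyer.Theorems.GoldfeldGoodTwists (not_isSoluble_two_of_zmodPow)

/-! ## §1 `ℚ_r`-insolubility of diagonal quartics `w² = d u⁴ + d′ z⁴` -/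

section Local

variable {r : ℕ} [hr : Fact r.Prime]

/-- In `ℤ_r`: `x mod r = 0 ↔ r ∣ x`. [folklore] -/
private theorem toZMod_eq_zero_iff_dvd (x : ℤ_[r]) : PadicInt.toZMod x = 0 ↔ (r : ℤ_[r]) ∣ x := by
  rw [← RingHom.mem_ker, PadicInt.ker_toZMod, PadicInt.maximalIdeal_eq_span_p, Ideal.mem_span_singleton]

/-- An integer divisible by `r` in `ℤ_r` is divisible by `r` in `ℤ`. [folklore] -/
private theorem int_dvd_of_padicInt_dvd {e : ℤ} (h : (r : ℤ_[r]) ∣ (e : ℤ_[r])) : (r : ℤ) ∣ e := by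
  have h2 := (toZMod_eq_zero_iff_dvd _).mpr h
  rw [map_intCast] at h2
  exact (ZMod.intCast_zmod_eq_zero_iff_dvd e r).mp h2

/-- Chart normal form for the diagonal quartic: a `ℚ_r`-point of `w² = d u⁴ + d′ z⁴` gives `s, t ∈ ℤ_r` with `s² = d + d′ t⁴` or
`s² = d′ + d t⁴`. [cite: Zywina2025, Lemma 3.1 (proof)] -/
theorem exists_padicInt_of_isSoluble_diagonal {d d' : ℤ}
    (h : ((twoIsogenyQuartic 0 d d').map (Int.castRingHom ℚ_[r])).IsSoluble) :
    (∃ t s : ℤ_[r], s ^ 2 = (d : ℤ_[r]) + (d' : ℤ_[r]) * t ^ 4) ∨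
      (∃ t s : ℤ_[r], s ^ 2 = (d' : ℤ_[r]) + (d : ℤ_[r]) * t ^ 4) := by
  obtain ⟨e, e', hee, t, s, hs⟩ := exists_padicInt_of_isSoluble h
  rcases hee with ⟨he, he'⟩ | ⟨he, he'⟩
  · left
    refine ⟨t, s, ?_⟩
    rw [hs, he, he']; push_cast; ring
  · right
    refine ⟨t, s, ?_⟩
    rw [hs, he, he']; push_cast; ring

/-- ★ **`d` a non-residue, `d′ = r² e′` with `e′` a non-residue ⇒ `w² = d u⁴ + d′ z⁴` has no `ℚ_r`-point.** Chart `u = 1`: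
`s² ≡ d (mod r)`; chart `z = 1`: `s² ≡ d t⁴`, so `t ≡ s ≡ 0`, `s = r s₁`, `t = r t₁`, `s₁² ≡ e′ (mod r)`. (In the cell: the
`q`-adic death of the classes `−1, 2, p, −2p` of `S^{(φ)}`.) [cite: SilvermanAEC2009, Prop. X.4.9 and proof of Prop. X.6.2(b)] -/
theorem not_isSoluble_padic_of_nonsquare_of_sq_mul {d d' e' : ℤ} (hd' : d' = (r : ℤ) ^ 2 * e')
    (hd : ¬ IsSquare ((d : ℤ) : ZMod r)) (he : ¬ IsSquare ((e' : ℤ) : ZMod r)) :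
    ¬ ((twoIsogenyQuartic 0 d d').map (Int.castRingHom ℚ_[r])).IsSoluble := by
  have hrr : Prime (r : ℤ_[r]) := PadicInt.prime_p
  intro h
  rcases exists_padicInt_of_isSoluble_diagonal h with ⟨t, s, hs⟩ | ⟨t, s, hs⟩
  · -- chart `u = 1`: `s² = d + r² e′ t⁴`
    rw [hd'] at hs
    push_cast at hs
    have h0 : PadicInt.toZMod s ^ 2 = ((d : ℤ) : ZMod r) := by simpa using congrArg PadicInt.toZMod hs
    exact hd ⟨PadicInt.toZMod s, by rw [← sq, h0]⟩
  · -- chart `z = 1`: `s² = r² e′ + d t⁴`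
    rw [hd'] at hs
    push_cast at hs
    have h0 : PadicInt.toZMod s ^ 2 = ((d : ℤ) : ZMod r) * PadicInt.toZMod t ^ 4 := by
      simpa using congrArg PadicInt.toZMod hs
    by_cases ht : PadicInt.toZMod t = 0
    · rw [ht, zero_pow four_ne_zero, mul_zero] at h0
      have hs0 : PadicInt.toZMod s = 0 := pow_eq_zero_iff two_ne_zero |>.mp h0
      obtain ⟨s₁, rfl⟩ := (toZMod_eq_zero_iff_dvd s).mp hs0
      obtain ⟨t₁, rfl⟩ := (toZMod_eq_zero_iff_dvd t).mp ht
      have h1 : s₁ ^ 2 = (e' : ℤ_[r]) + (d : ℤ_[r]) * (r : ℤ_[r]) ^ 2 * t₁ ^ 4 :=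
        mul_left_cancel₀ (pow_ne_zero 2 hrr.ne_zero) (by linear_combination hs)
      have h2 : PadicInt.toZMod s₁ ^ 2 = ((e' : ℤ) : ZMod r) := by simpa using congrArg PadicInt.toZMod h1
      exact he ⟨PadicInt.toZMod s₁, by rw [← sq, h2]⟩
    · exact hd ⟨PadicInt.toZMod s / PadicInt.toZMod t ^ 2, by field_simp; linear_combination -h0⟩

/-- ★ **`d` a non-residue, `d′ = r e′` with `r ∤ e′` ⇒ no `ℚ_r`-point.** Chart `u = 1`: `s² ≡ d`; chart `z = 1`: `s² ≡ d t⁴`,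
`t ≡ s ≡ 0`, and then `r s₁² = e′ + d r³ t₁⁴` forces `r ∣ e′`. (The `p`-adic death of the class `−2` of `S^{(φ)}`, `k = 1`.)
[cite: SilvermanAEC2009, Prop. X.4.9] -/
theorem not_isSoluble_padic_of_nonsquare_of_dvd {d d' e' : ℤ} (hd' : d' = (r : ℤ) * e') (he : ¬ (r : ℤ) ∣ e')
    (hd : ¬ IsSquare ((d : ℤ) : ZMod r)) :
    ¬ ((twoIsogenyQuartic 0 d d').map (Int.castRingHom ℚ_[r])).IsSoluble := by
  have hrr : Prime (r : ℤ_[r]) := PadicInt.prime_p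
  intro h
  rcases exists_padicInt_of_isSoluble_diagonal h with ⟨t, s, hs⟩ | ⟨t, s, hs⟩
  · rw [hd'] at hs
    push_cast at hs
    have h0 : PadicInt.toZMod s ^ 2 = ((d : ℤ) : ZMod r) := by simpa using congrArg PadicInt.toZMod hs
    exact hd ⟨PadicInt.toZMod s, by rw [← sq, h0]⟩
  · rw [hd'] at hs
    push_cast at hs
    have h0 : PadicInt.toZMod s ^ 2 = ((d : ℤ) : ZMod r) * PadicInt.toZMod t ^ 4 := by
      simpa using congrArg PadicInt.toZMod hs
    by_cases ht : PadicInt.toZMod t = 0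
    · rw [ht, zero_pow four_ne_zero, mul_zero] at h0
      have hs0 : PadicInt.toZMod s = 0 := pow_eq_zero_iff two_ne_zero |>.mp h0
      obtain ⟨s₁, rfl⟩ := (toZMod_eq_zero_iff_dvd s).mp hs0
      obtain ⟨t₁, rfl⟩ := (toZMod_eq_zero_iff_dvd t).mp ht
      have h1 : (r : ℤ_[r]) * s₁ ^ 2 = (e' : ℤ_[r]) + (d : ℤ_[r]) * (r : ℤ_[r]) ^ 3 * t₁ ^ 4 :=
        mul_left_cancel₀ hrr.ne_zero (by linear_combination hs)
      exact he (int_dvd_of_padicInt_dvd ⟨s₁ ^ 2 - (d : ℤ_[r]) * (r : ℤ_[r]) ^ 2 * t₁ ^ 4, by linear_combination -h1⟩)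
    · exact hd ⟨PadicInt.toZMod s / PadicInt.toZMod t ^ 2, by field_simp; linear_combination -h0⟩

/-- ★ **`d` a non-residue, `d′ = r³ e′` with `r ∤ e′` ⇒ no `ℚ_r`-point** (one step more: `s₁² = r e′ + d r² t₁⁴` forces `r ∣ s₁`,
then `r ∣ e′`). (The class `−2` of `S^{(φ)}`, `k = 3`.) [cite: SilvermanAEC2009, Prop. X.4.9] -/
theorem not_isSoluble_padic_of_nonsquare_of_cube_mul {d d' e' : ℤ} (hd' : d' = (r : ℤ) ^ 3 * e') (he : ¬ (r : ℤ) ∣ e')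
    (hd : ¬ IsSquare ((d : ℤ) : ZMod r)) :
    ¬ ((twoIsogenyQuartic 0 d d').map (Int.castRingHom ℚ_[r])).IsSoluble := by
  have hrr : Prime (r : ℤ_[r]) := PadicInt.prime_p
  intro h
  rcases exists_padicInt_of_isSoluble_diagonal h with ⟨t, s, hs⟩ | ⟨t, s, hs⟩
  · rw [hd'] at hs
    push_cast at hs
    have h0 : PadicInt.toZMod s ^ 2 = ((d : ℤ) : ZMod r) := by simpa using congrArg PadicInt.toZMod hs
    exact hd ⟨PadicInt.toZMod s, by rw [← sq, h0]⟩
  · rw [hd'] at hs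
    push_cast at hs
    have h0 : PadicInt.toZMod s ^ 2 = ((d : ℤ) : ZMod r) * PadicInt.toZMod t ^ 4 := by
      simpa using congrArg PadicInt.toZMod hs
    by_cases ht : PadicInt.toZMod t = 0
    · rw [ht, zero_pow four_ne_zero, mul_zero] at h0
      have hs0 : PadicInt.toZMod s = 0 := pow_eq_zero_iff two_ne_zero |>.mp h0
      obtain ⟨s₁, rfl⟩ := (toZMod_eq_zero_iff_dvd s).mp hs0
      obtain ⟨t₁, rfl⟩ := (toZMod_eq_zero_iff_dvd t).mp ht
      have h1 : s₁ ^ 2 = (r : ℤ_[r]) * ((e' : ℤ_[r]) + (d : ℤ_[r]) * (r : ℤ_[r]) * t₁ ^ 4) :=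
        mul_left_cancel₀ (pow_ne_zero 2 hrr.ne_zero) (by linear_combination hs)
      obtain ⟨s₂, rfl⟩ : (r : ℤ_[r]) ∣ s₁ := hrr.dvd_of_dvd_pow ⟨_, h1⟩
      have h3 : (r : ℤ_[r]) * s₂ ^ 2 = (e' : ℤ_[r]) + (d : ℤ_[r]) * (r : ℤ_[r]) * t₁ ^ 4 :=
        mul_left_cancel₀ hrr.ne_zero (by linear_combination h1)
      exact he (int_dvd_of_padicInt_dvd ⟨s₂ ^ 2 - (d : ℤ_[r]) * t₁ ^ 4, by linear_combination -h3⟩)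
    · exact hd ⟨PadicInt.toZMod s / PadicInt.toZMod t ^ 2, by field_simp; linear_combination -h0⟩

/-- ★ **`r ∥ d` (`d = r d₁`, `r ∤ d₁`), `d′ = r² e′` with `e′` a non-residue ⇒ no `ℚ_r`-point.** Chart `u = 1`: `s² = r d₁ + r² e′ t⁴`
forces `r ∣ s`, then `r ∣ d₁`; chart `z = 1`: `s² = r² e′ + r d₁ t⁴` forces `r ∣ s`, `r ∣ t`, then `s₁² ≡ e′ (mod r)`. (The class `2p`
of `S^{(φ)}`, `k = 3`.) [cite: SilvermanAEC2009, Prop. X.4.9] -/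
theorem not_isSoluble_padic_of_dvd_of_sq_mul {d d₁ d' e' : ℤ} (hd : d = (r : ℤ) * d₁) (hd₁ : ¬ (r : ℤ) ∣ d₁)
    (hd' : d' = (r : ℤ) ^ 2 * e') (he : ¬ IsSquare ((e' : ℤ) : ZMod r)) :
    ¬ ((twoIsogenyQuartic 0 d d').map (Int.castRingHom ℚ_[r])).IsSoluble := by
  have hrr : Prime (r : ℤ_[r]) := PadicInt.prime_p
  intro h
  rcases exists_padicInt_of_isSoluble_diagonal h with ⟨t, s, hs⟩ | ⟨t, s, hs⟩
  · -- chart `u = 1`: `s² = r d₁ + r² e′ t⁴`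
    rw [hd, hd'] at hs
    push_cast at hs
    obtain ⟨s₁, rfl⟩ : (r : ℤ_[r]) ∣ s := hrr.dvd_of_dvd_pow ⟨(d₁ : ℤ_[r]) + r * e' * t ^ 4, by rw [hs]; ring⟩
    exact hd₁ (int_dvd_of_padicInt_dvd ⟨s₁ ^ 2 - (e' : ℤ_[r]) * t ^ 4,
      mul_left_cancel₀ hrr.ne_zero (by linear_combination -hs)⟩)
  · -- chart `z = 1`: `s² = r² e′ + r d₁ t⁴`
    rw [hd, hd'] at hs
    push_cast at hs
    obtain ⟨s₁, rfl⟩ : (r : ℤ_[r]) ∣ s := hrr.dvd_of_dvd_pow ⟨(r : ℤ_[r]) * e' + d₁ * t ^ 4, by rw [hs]; ring⟩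
    have h1 : (d₁ : ℤ_[r]) * t ^ 4 = r * (s₁ ^ 2 - e') := mul_left_cancel₀ hrr.ne_zero (by linear_combination -hs)
    have hrt : (r : ℤ_[r]) ∣ t := by
      rcases hrr.dvd_or_dvd (⟨_, h1⟩ : (r : ℤ_[r]) ∣ (d₁ : ℤ_[r]) * t ^ 4) with h' | h'
      · exact absurd (int_dvd_of_padicInt_dvd h') hd₁
      · exact hrr.dvd_of_dvd_pow h'
    obtain ⟨t₁, rfl⟩ := hrt
    have h3 : s₁ ^ 2 = (e' : ℤ_[r]) + (d₁ : ℤ_[r]) * (r : ℤ_[r]) ^ 3 * t₁ ^ 4 :=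
      mul_left_cancel₀ hrr.ne_zero (by linear_combination -h1)
    have h4 : PadicInt.toZMod s₁ ^ 2 = ((e' : ℤ) : ZMod r) := by simpa using congrArg PadicInt.toZMod h3
    exact he ⟨PadicInt.toZMod s₁, by rw [← sq, h4]⟩

end Local

/-! ## §2 The `2`-adic residues of the classes `q` and `pq` of `S^{(φ̂)}(X_B)`, `B = p^k q² l²` -/

section TwoAdic

/-- Residues modulo `16` for the class `q` (`q = 8N + 3`, `p^k ≡ 15`, `l² ≡ 9`): both charts of `w² = q u⁴ + (p^k q l²) z⁴` are insoluble
modulo `16` (the `u⁴ z⁴`-mixed sum is `≡ 8`, the pure terms `≡ 3, 5 (mod 8)`). [folklore] -/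
theorem zmod_key_q :
    (∀ N T S : ZMod (2 ^ 4), S ^ 2 ≠ 8 * N + 3 + 0 * T ^ 2 + 15 * (8 * N + 3) * 9 * T ^ 4) ∧
    (∀ N T S : ZMod (2 ^ 4), S ^ 2 ≠ 15 * (8 * N + 3) * 9 + 0 * T ^ 2 + (8 * N + 3) * T ^ 4) :=
  ⟨by decide, by decide⟩

/-- Residues modulo `16` for the class `pq` (`pq ≡ 15q`, `B/(pq) = p^{k−1} q l² ≡ 9q`): both charts of `w² = pq u⁴ + (p^{k−1} q l²) z⁴`
are insoluble modulo `16`. [folklore] -/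
theorem zmod_key_pq :
    (∀ N T S : ZMod (2 ^ 4), S ^ 2 ≠ 15 * (8 * N + 3) + 0 * T ^ 2 + 1 * (8 * N + 3) * 9 * T ^ 4) ∧
    (∀ N T S : ZMod (2 ^ 4), S ^ 2 ≠ 1 * (8 * N + 3) * 9 + 0 * T ^ 2 + 15 * (8 * N + 3) * T ^ 4) :=
  ⟨by decide, by decide⟩

variable {p q l k : ℕ}

/-- `p ≡ 15 (mod 16)` in `ℤ/16`. [folklore] -/
theorem cast_zmod16_eq (hp16 : p % 16 = 15) : (p : ZMod (2 ^ 4)) = 15 := by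
  rw [← ZMod.natCast_mod p (2 ^ 4), show p % 2 ^ 4 = 15 by omega]
  rfl

/-- `p^k ≡ 15 (mod 16)` for `p ≡ 15 (mod 16)`, `k ∈ {1, 3}`. [folklore] -/
theorem pow_cast_zmod16_eq (hp16 : p % 16 = 15) (hk : k = 1 ∨ k = 3) : (p : ZMod (2 ^ 4)) ^ k = 15 := by
  rw [cast_zmod16_eq hp16]; rcases hk with rfl | rfl <;> decide

/-- `p^{k−1} ≡ 1 (mod 16)` for `p ≡ 15 (mod 16)`, `k ∈ {1, 3}`. [folklore] -/
theorem pow_pred_cast_zmod16_eq (hp16 : p % 16 = 15) (hk : k = 1 ∨ k = 3) : (p : ZMod (2 ^ 4)) ^ (k - 1) = 1 := by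
  rw [cast_zmod16_eq hp16]; rcases hk with rfl | rfl <;> decide

/-- `l² ≡ 9 (mod 16)` for `l ≡ 5 (mod 8)`. [folklore] -/
theorem sq_cast_zmod16_eq (hl8 : l % 8 = 5) : (l : ZMod (2 ^ 4)) ^ 2 = 9 := by
  rw [← ZMod.natCast_mod l (2 ^ 4)]
  rcases (show l % 2 ^ 4 = 5 ∨ l % 2 ^ 4 = 13 by omega) with h | h <;> rw [h] <;> decide

/-- ★ **The class `q` of `S^{(φ̂)}(X_B)` has no `ℚ₂`-point** (`B/q = p^k q l²`; `p ≡ 15 (mod 16)`, `q ≡ 3`, `l ≡ 5 (mod 8)`, `k ∈ {1,3}`).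
[cite: SilvermanAEC2009, Prop. X.4.9] -/
theorem not_isSoluble_two_q (hp16 : p % 16 = 15) (hq8 : q % 8 = 3) (hl8 : l % 8 = 5) (hk : k = 1 ∨ k = 3) :
    ¬ ((twoIsogenyQuartic 0 (q : ℤ) ((p : ℤ) ^ k * q * l ^ 2)).map (Int.castRingHom ℚ_[2])).IsSoluble := by
  obtain ⟨N, hN⟩ : ∃ N : ℕ, (q : ℤ) = 8 * N + 3 := ⟨q / 8, by omega⟩
  refine not_isSoluble_two_of_zmodPow 4 4 (fun T S => ?_) (fun T S => ?_)
  · have := zmod_key_q.1 (N : ZMod (2 ^ 4)) T S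
    rw [hN]; push_cast
    rw [pow_cast_zmod16_eq hp16 hk, sq_cast_zmod16_eq hl8]
    convert this using 2
  · have := zmod_key_q.2 (N : ZMod (2 ^ 4)) T S
    rw [hN]; push_cast
    rw [pow_cast_zmod16_eq hp16 hk, sq_cast_zmod16_eq hl8]
    convert this using 2

/-- ★ **The class `pq` of `S^{(φ̂)}(X_B)` has no `ℚ₂`-point** (`B/(pq) = p^{k−1} q l²`; same congruence data).
[cite: SilvermanAEC2009, Prop. X.4.9] -/
theorem not_isSoluble_two_pq (hp16 : p % 16 = 15) (hq8 : q % 8 = 3) (hl8 : l % 8 = 5) (hk : k = 1 ∨ k = 3) :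
    ¬ ((twoIsogenyQuartic 0 ((p : ℤ) * q) ((p : ℤ) ^ (k - 1) * q * l ^ 2)).map (Int.castRingHom ℚ_[2])).IsSoluble := by
  obtain ⟨N, hN⟩ : ∃ N : ℕ, (q : ℤ) = 8 * N + 3 := ⟨q / 8, by omega⟩
  refine not_isSoluble_two_of_zmodPow 4 4 (fun T S => ?_) (fun T S => ?_)
  · have := zmod_key_pq.1 (N : ZMod (2 ^ 4)) T S
    rw [hN]; push_cast
    rw [pow_pred_cast_zmod16_eq hp16 hk, sq_cast_zmod16_eq hl8, cast_zmod16_eq hp16]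
    convert this using 2
  · have := zmod_key_pq.2 (N : ZMod (2 ^ 4)) T S
    rw [hN]; push_cast
    rw [pow_pred_cast_zmod16_eq hp16 hk, sq_cast_zmod16_eq hl8, cast_zmod16_eq hp16]
    convert this using 2

end TwoAdic

end Summit.BirchSwinnertonDyer.BirchSwinnertonDyer.Theorems.BiquadraticEisensteinDescentHeegnerTwistCouplingInSupplyQuarticLocal

end
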